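import Literature.Probability.Percolation.ZdFrontierSeparation
import HarnessLib

/-!
# Arms and their objects: the frontier of the cluster of an open crossing, and comparison lemmas

Topic `Literature/Probability/Percolation`; bond percolation on `ℤ² = Site 2`, the rectangle
`R = [0,M] × [0,N]`. PROOFS ONLY (no definition, no named fact).  Bricks of the EXTERNAL
per-scale lemma of Kesten's arm-separation theorem for four alternating arms (H. Kesten, CMP 109
(1987), §2, Lemma 4; P. Nolin, EJP 13 (2008), §4.4): the passage from an ARM (an open
left–right crossing `π` of `R`, the final segment of an arm of the four-arm event in a side
rectangle) to its OBJECT (the open cluster of `π` in `R`, `clusterConfig`) and the object's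
FRONTIER (`LowPath.mem_frontierEvent`, `ZdFrontierEvent.lean`), with the facts used to keep the
cyclic order of the tips when arms are re-routed to the tips of their frontiers:

* `exists_frontier_of_lrWalk` — for an `ω`-open left–right crossing `π` of `R` touching the right
  side only at its end `b`, there is a frontier set `S` with `ω ∈ frontierEvent M N S`, the
  cluster configuration of `S` is that of `π`, and the tip of `S` is NOT ABOVE `b`
  (`(tipOf M N S) 1 ≤ b 1`);
* `IsFrontierSet.mem_belowFaces_rightCol_of_lt` — the faces of the right column strictly below
  the tip of a frontier set are below it (flooded);
* `IsFrontierSet.rightCol_ge_of_faceWalk`, `IsFrontierSet.rightCol_lt_of_faceWalk` — along a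
  walk of faces of `R*` crossing only `ω`-closed edges (a closed dual arm, `S ⊆ ω`), being
  below `S` is constant (`mem_belowFaces_iff_of_walk`); hence such a walk starting at a right-column
  face at height `≥ τ_S` (resp. `< τ_S`) only visits right-column faces at heights `≥ τ_S`
  (resp. `< τ_S`).

## References

* H. Kesten, Comm. Math. Phys. 109 (1987), §2, Lemma 4 [KestenScalingCMP1987].
* P. Nolin, EJP 13 (2008), §4.4, Lemma 15 and its proof (arXiv 0711.4948: Lemma 14, p. 11) [Nolin2008].
* B. Bollobás, O. Riordan, *Percolation* (2006), Ch. 3, Lemma 1 [BollobasRiordan2006].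
-/

noncomputable section

open SimpleGraph Finset

namespace Literature.Probability.Percolation

open LatticeModels

variable {M N : ℕ} {ω : BondConfig (Site 2)} {S : Finset (Sym2 (Site 2))}

/-! ### Flooding along the right column -/

/-- **Flooding climbs the right column off the crossing**: if the face `(M-1, y₀)` of `R*` is
flooded for a configuration `ω₀` and no vertex `(M, y)` with `y₀ < y ≤ y₁` is a vertex of an
`ω₀`-edge, then the face `(M-1, y₁)` is flooded (`y₁ ≤ N`). [folklore] -/
theorem mem_dualBelowR_rightCol_up {ω₀ : BondConfig (Site 2)} (hω₀ : ω₀ ⊆ (zdGraph 2).edgeSet) (hM : 1 ≤ M) {y₀ : ℤ} {k : ℕ}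
    (h₀ : (![(M : ℤ) - 1, y₀] : Site 2) ∈ dualBelowR M N ω₀) (hy₁ : y₀ + k ≤ N)
    (hfree : ∀ y, y₀ < y → y ≤ y₀ + k → ∀ e ∈ ω₀, (![(M : ℤ), y] : Site 2) ∉ e) :
    (![(M : ℤ) - 1, y₀ + k] : Site 2) ∈ dualBelowR M N ω₀ := by
  induction k with
  | zero => simpa using h₀
  | succ k ih =>
    have ih' := ih (by push_cast at hy₁; omega) (fun y h1 h2 => hfree y h1 (by push_cast; omega))
    have hR₀ := mem_dualRectangle_iff.1 (dualBelowR_subset ih')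
    simp only [Matrix.cons_val_zero, Matrix.cons_val_one] at hR₀
    set f : Site 2 := ![(M : ℤ) - 1, y₀ + k] with hf
    set f' : Site 2 := ![(M : ℤ) - 1, y₀ + ((k + 1 : ℕ) : ℤ)] with hf'
    have hff' : f' = f + Pi.single 1 1 := by
      rw [Site.eq_iff_two]
      simp only [hf, hf', Pi.add_apply, single_one_apply_zero, single_one_apply_one, Matrix.cons_val_zero,
        Matrix.cons_val_one, Nat.cast_add, Nat.cast_one]
      omega
    have hadj : (zdGraph 2).Adj f f' := by rw [hff']; exact adj_of_stepKind (.up (by simp) (by simp))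
    have hf'R : f' ∈ dualRectangle M N := by
      rw [mem_dualRectangle_iff]; simp only [hf', Matrix.cons_val_zero, Matrix.cons_val_one]; push_cast at hy₁ ⊢; omega
    -- the edge between `f` and `f'` is `{(M-1, y₀+k+1), (M, y₀+k+1)}`, not in `ω₀`
    have hedge : sepEdge f f' ∉ ω₀ := by
      intro he
      have hmem : (![(M : ℤ), y₀ + k + 1] : Site 2) ∈ sepEdge f f' := by
        rw [hff', sepEdge_up]
        have : (f + Pi.single 1 1 + Pi.single 0 1 : Site 2) = ![(M : ℤ), y₀ + k + 1] := by
          rw [Site.eq_iff_two]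
          simp only [hf, Pi.add_apply, single_zero_apply_zero, single_zero_apply_one, single_one_apply_zero,
            single_one_apply_one, Matrix.cons_val_zero, Matrix.cons_val_one]
          constructor <;> ring
        rw [← this]; exact Sym2.mem_mk_right _ _
      exact hfree (y₀ + k + 1) (by omega) (by push_cast; omega) _ he hmem
    exact mem_dualBelowR_of_adj ih' hf'R ((mem_dualConfig_mk_iff hω₀ hadj).2 hedge)

namespace IsFrontierSet

/-- **The faces of the right column strictly below the tip of a frontier set are flooded** (for the
configuration `↑S`): `(M-1, y) ∈ belowFaces M N S` for `-1 ≤ y < τ_S`. [folklore] -/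
theorem mem_belowFaces_rightCol_of_lt (hS : IsFrontierSet M N S) (hM : 1 ≤ M) {y : ℤ} (hy : y < (tipOf M N S) 1)
    (hy' : -1 ≤ y) : (![(M : ℤ) - 1, y] : Site 2) ∈ belowFaces M N S := by
  obtain ⟨Λ⟩ := nonempty_lowPath (ω := (↑S : BondConfig (Site 2))) hM hS.2
  have hb : Λ.b = tipOf M N S := Λ.b_eq_tipOf_coe hM hS.2
  -- climb from the bottom face `(M-1, -1)`
  obtain ⟨k, rfl⟩ : ∃ k : ℕ, y = -1 + k := ⟨(y + 1).toNat, by omega⟩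
  have hbot : (![(M : ℤ) - 1, -1] : Site 2) ∈ dualBelowR M N (↑S : BondConfig (Site 2)) := by
    have hmem : (![(M : ℤ) - 1, -1] : Site 2) ∈ dualBottomSide M N := by
      rw [dualBottomSide, Finset.mem_filter, mem_dualRectangle_iff]
      simp only [Matrix.cons_val_zero, Matrix.cons_val_one, and_true]; omega
    exact mem_dualBelowR_iff.2 ⟨(Finset.mem_filter.1 hmem).1, _, hmem, openConnIn_refl (Finset.mem_filter.1 hmem).1⟩
  have htipR := mem_rectangle_iff.1 Λ.b_mem_rectangle
  rw [← hb] at hy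
  refine mem_belowFaces_iff.2 (mem_dualBelowR_rightCol_up hS.subset_edgeSet hM hbot (by omega) fun y' h1 h2 e he hye => ?_)
  -- a vertex `(M, y')` with `y' < τ` on an `S`-edge would be on the lowest crossing
  have hv : (![(M : ℤ), y'] : Site 2) ∈ Λ.path.support :=
    (hS.mem_edgeVerts_iff_mem_support hM Λ).1 ⟨e, Finset.mem_coe.1 he, hye⟩
  exact Λ.not_mem_support_right_of_lt hM (w := ![(M : ℤ), y']) (by simp) (by simp; omega) hv

/-- **Being below a frontier set is constant along a closed dual walk** (`S ⊆ ω`, the walk of faces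
stays in `R*` and crosses only `ω`-closed edges). [folklore] -/
theorem _root_.Literature.Probability.Percolation.mem_belowFaces_iff_of_closedWalk (hSω : (↑S : Set (Sym2 (Site 2))) ⊆ ω) {f g : Site 2}
    (W : (zdGraph 2).Walk f g) (hWR : ∀ z ∈ W.support, z ∈ dualRectangle M N)
    (hWc : ∀ d ∈ W.darts, sepEdge d.fst d.snd ∉ ω) :
    ∀ z ∈ W.support, (z ∈ belowFaces M N S ↔ f ∈ belowFaces M N S) :=
  mem_belowFaces_iff_of_walk W hWR fun d hd hS' => hWc d hd (hSω (Finset.mem_coe.2 hS'))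

/-- **A closed dual walk starting at a right-column face at height `≥ τ_S` never visits a
right-column face below `τ_S`.** [folklore] -/
theorem rightCol_ge_of_faceWalk (hS : IsFrontierSet M N S) (hM : 1 ≤ M) (hSω : (↑S : Set (Sym2 (Site 2))) ⊆ ω)
    {y₀ : ℤ} (hy₀ : (tipOf M N S) 1 ≤ y₀) (hy₀N : y₀ ≤ N) {g : Site 2}
    (W : (zdGraph 2).Walk (![(M : ℤ) - 1, y₀] : Site 2) g) (hWR : ∀ z ∈ W.support, z ∈ dualRectangle M N)
    (hWc : ∀ d ∈ W.darts, sepEdge d.fst d.snd ∉ ω) {y : ℤ} (hy : (![(M : ℤ) - 1, y] : Site 2) ∈ W.support) :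
    (tipOf M N S) 1 ≤ y := by
  obtain ⟨Λ⟩ := nonempty_lowPath (ω := (↑S : BondConfig (Site 2))) hM hS.2
  have hb : Λ.b = tipOf M N S := Λ.b_eq_tipOf_coe hM hS.2
  -- the start is an above face, hence not flooded
  have hstart : (![(M : ℤ) - 1, y₀] : Site 2) ∉ belowFaces M N S := by
    have hA := Λ.isAboveFace_rightCol hM hS.2 (y := y₀) (by rw [hb]; exact hy₀) hy₀N
    exact fun h => hA.not_mem_dualBelowR (mem_belowFaces_iff.1 h)
  by_contra hlt
  push Not at hlt
  have hyR := mem_dualRectangle_iff.1 (hWR _ hy)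
  simp only [Matrix.cons_val_zero, Matrix.cons_val_one] at hyR
  have hflood := hS.mem_belowFaces_rightCol_of_lt hM hlt hyR.2.2.1
  exact hstart ((mem_belowFaces_iff_of_closedWalk hSω W hWR hWc _ hy).1 hflood)

/-- **A closed dual walk starting at a right-column face below `τ_S` never visits a right-column
face at height `≥ τ_S`.** [folklore] -/
theorem rightCol_lt_of_faceWalk (hS : IsFrontierSet M N S) (hM : 1 ≤ M) (hSω : (↑S : Set (Sym2 (Site 2))) ⊆ ω)
    {y₀ : ℤ} (hy₀ : y₀ < (tipOf M N S) 1) (hy₀' : -1 ≤ y₀) {g : Site 2}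
    (W : (zdGraph 2).Walk (![(M : ℤ) - 1, y₀] : Site 2) g) (hWR : ∀ z ∈ W.support, z ∈ dualRectangle M N)
    (hWc : ∀ d ∈ W.darts, sepEdge d.fst d.snd ∉ ω) {y : ℤ} (hy : (![(M : ℤ) - 1, y] : Site 2) ∈ W.support) :
    y < (tipOf M N S) 1 := by
  obtain ⟨Λ⟩ := nonempty_lowPath (ω := (↑S : BondConfig (Site 2))) hM hS.2
  have hb : Λ.b = tipOf M N S := Λ.b_eq_tipOf_coe hM hS.2
  have hstart : (![(M : ℤ) - 1, y₀] : Site 2) ∈ belowFaces M N S := hS.mem_belowFaces_rightCol_of_lt hM hy₀ hy₀'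
  by_contra hge
  push Not at hge
  have hyR := mem_dualRectangle_iff.1 (hWR _ hy)
  simp only [Matrix.cons_val_zero, Matrix.cons_val_one] at hyR
  have hflood : (![(M : ℤ) - 1, y] : Site 2) ∈ belowFaces M N S :=
    (mem_belowFaces_iff_of_closedWalk hSω W hWR hWc _ hy).2 hstart
  -- but faces of the right column at height `≥ τ` (and `≤ N`) are above
  have hA := Λ.isAboveFace_rightCol hM hS.2 (y := y) (by rw [hb]; exact hge) hyR.2.2.2
  exact hA.not_mem_dualBelowR (mem_belowFaces_iff.1 hflood)

end IsFrontierSet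

/-! ### From an open crossing to the frontier of its cluster -/

/-- The vertices of the edges of a walk are pairwise joined by open sub-walks. [folklore] -/
theorem pairwise_joined_edges_toFinset {a b : Site 2} (π : (zdGraph 2).Walk a b)
    (hπR : ∀ z ∈ π.support, z ∈ rectangle M N) (hπω : ∀ e ∈ π.edges, e ∈ ω) :
    ∀ y ∈ edgeVerts (↑π.edges.toFinset : Set (Sym2 (Site 2))), ∀ y' ∈ edgeVerts (↑π.edges.toFinset : Set (Sym2 (Site 2))),
      ∃ W : (zdGraph 2).Walk y y', (∀ z ∈ W.support, z ∈ rectangle M N) ∧ ∀ e ∈ W.edges, e ∈ ω := by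
  classical
  have hsupp : ∀ y ∈ edgeVerts (↑π.edges.toFinset : Set (Sym2 (Site 2))), y ∈ π.support := by
    intro y hy
    obtain ⟨e, he, hye⟩ := mem_edgeVerts_coe_iff.1 hy
    rw [List.mem_toFinset] at he
    induction e using Sym2.ind with
    | h u v =>
      rcases Sym2.mem_iff.1 hye with rfl | rfl
      · exact π.fst_mem_support_of_mem_edges he
      · exact π.snd_mem_support_of_mem_edges he
  intro y hy y' hy'
  have h1 := hsupp y hy
  have h2 := hsupp y' hy'
  -- the sub-walk of `π` between `y` and `y'`
  refine ⟨(π.takeUntil y h1).reverse.append (π.takeUntil y' h2), fun z hz => ?_, fun e he => ?_⟩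
  · rw [Walk.mem_support_append_iff, Walk.support_reverse, List.mem_reverse] at hz
    rcases hz with hz | hz
    · exact hπR z (π.support_takeUntil_subset_support h1 hz)
    · exact hπR z (π.support_takeUntil_subset_support h2 hz)
  · rw [Walk.edges_append, List.mem_append, Walk.edges_reverse, List.mem_reverse] at he
    rcases he with he | he
    · exact hπω e (π.edges_takeUntil_subset_edges h1 he)
    · exact hπω e (π.edges_takeUntil_subset_edges h2 he)

/-- **The object of an arm and its frontier.**  Let `π` be an `ω`-open left–right crossing of
`R = [0,M] × [0,N]` (`M ≥ 1`) touching the right side only at its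
end `b`.  Then the cluster of `π` in `R` has a frontier: a frontier set `S` with
`ω ∈ frontierEvent M N S`, `clusterConfig M N ω S = clusterConfig M N ω π.edges`, and the tip of
`S` is not above `b`. [cite: Nolin2008, §4.4, proof of Lemma 15 (arXiv 0711.4948: Lemma 14, p. 11)] -/
theorem exists_frontier_of_lrWalk (hM : 1 ≤ M) {a b : Site 2}
    (π : (zdGraph 2).Walk a b) (ha : a 0 = 0) (hb : b 0 = M)
    (hπR : ∀ z ∈ π.support, z ∈ rectangle M N) (hπω : ∀ e ∈ π.edges, e ∈ ω)
    (honly : ∀ z ∈ π.support, z 0 = M → z = b) :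
    ∃ S : Finset (Sym2 (Site 2)), IsFrontierSet M N S ∧ ω ∈ frontierEvent M N S ∧
      clusterConfig M N ω S = clusterConfig M N ω π.edges.toFinset ∧ (tipOf M N S) 1 ≤ b 1 := by
  classical
  set T := π.edges.toFinset with hTdef
  have hT := pairwise_joined_edges_toFinset (M := M) (N := N) π hπR hπω
  set K := clusterConfig M N ω T with hK
  -- `π ⊆ K`
  have hπK : ∀ e ∈ π.edges, e ∈ K := by
    intro e he
    have heT : e ∈ T := List.mem_toFinset.2 he
    refine subset_clusterConfig (fun e' he' => ?_) (fun e' he' => hπω e' (List.mem_toFinset.1 (Finset.mem_coe.1 he')))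
      (Finset.mem_coe.2 heT)
    have he'' := List.mem_toFinset.1 he'
    refine ⟨π.edges_subset_edgeSet he'', fun x hx => ?_⟩
    induction e' using Sym2.ind with
    | h u v =>
      rcases Sym2.mem_iff.1 hx with rfl | rfl
      · exact hπR _ (π.fst_mem_support_of_mem_edges he'')
      · exact hπR _ (π.snd_mem_support_of_mem_edges he'')
  have hTK : ∀ t ∈ dualTopSide M N, t ∉ dualBelowR M N K := not_mem_dualBelowR_of_lrWalk π ha hb hπR hπK
  obtain ⟨Λ⟩ := nonempty_lowPath (ω := K) hM hTK
  obtain ⟨hS, hω, heq⟩ := Λ.mem_frontierEvent hM hT hTK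
  refine ⟨Λ.edgeFinset, hS, hω, heq, ?_⟩
  -- the tip is not above `b`: otherwise the flood of `π` would reach the top row along the right column
  obtain ⟨Λ₀⟩ := nonempty_lowPath (ω := (↑Λ.edgeFinset : BondConfig (Site 2))) hM hS.2
  have hbb : Λ.b = Λ₀.b :=
    LowPath.b_eq_of_edges_iff hM Λ Λ₀ fun e => by rw [Λ₀.mem_edges_iff, hS.1, Λ.mem_edgeFinset_iff]
  rw [← Λ₀.b_eq_tipOf_coe hM hS.2, ← hbb]
  by_contra hlt
  push Not at hlt
  have hbR := mem_rectangle_iff.1 (hπR b π.end_mem_support)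
  have htipR := mem_rectangle_iff.1 Λ.b_mem_rectangle
  -- the face just under the tip is `K`-flooded, hence flooded for `↑π.edges`
  have hflood : (![(M : ℤ) - 1, Λ.b 1 - 1] : Site 2) ∈ dualBelowR M N (↑T : BondConfig (Site 2)) :=
    dualBelowR_anti (fun e he => hπK e (List.mem_toFinset.1 (Finset.mem_coe.1 he))) (Λ.mem_dualBelowR_below_tip hM hTK)
  -- climb to the top face along the right column: no `π`-vertex `(M, y)` with `y > b 1`
  obtain ⟨k, hk⟩ : ∃ k : ℕ, (N : ℤ) = Λ.b 1 - 1 + k := ⟨(N - (Λ.b 1 - 1)).toNat, by omega⟩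
  have htop := mem_dualBelowR_rightCol_up (ω₀ := (↑T : BondConfig (Site 2)))
    (fun e he => π.edges_subset_edgeSet (List.mem_toFinset.1 (Finset.mem_coe.1 he))) hM hflood (k := k) (by omega)
    (fun y h1 h2 e he hye => by
      have he' := List.mem_toFinset.1 (Finset.mem_coe.1 he)
      have hv : (![(M : ℤ), y] : Site 2) ∈ π.support := by
        induction e using Sym2.ind with
        | h u v =>
          rcases Sym2.mem_iff.1 hye with h | h
          · exact h ▸ π.fst_mem_support_of_mem_edges he'
          · exact h ▸ π.snd_mem_support_of_mem_edges he'
      have := honly _ hv (by simp)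
      have h1' := congrFun this 1
      simp at h1'
      omega)
  rw [← hk] at htop
  have htopSide : (![(M : ℤ) - 1, (N : ℤ)] : Site 2) ∈ dualTopSide M N := by
    rw [dualTopSide, Finset.mem_filter, mem_dualRectangle_iff]
    simp only [Matrix.cons_val_zero, Matrix.cons_val_one, and_true]; omega
  exact not_mem_dualBelowR_of_lrWalk π ha hb hπR (ω := (↑T : BondConfig (Site 2)))
    (fun e he => Finset.mem_coe.2 (List.mem_toFinset.2 he)) _ htopSide htop

/-- **Cutting an arm at its first visit to the right side**: an open walk of `R` from the left side
reaching the right side contains an open left–right crossing touching the right side only at its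
end, whose edges are among the original ones. [folklore] -/
theorem exists_lrWalk_prefix {a c : Site 2} (π : (zdGraph 2).Walk a c) (hc : c 0 = M)
    (hπR : ∀ z ∈ π.support, z ∈ rectangle M N) (hπω : ∀ e ∈ π.edges, e ∈ ω) :
    ∃ (b : Site 2) (π' : (zdGraph 2).Walk a b), b 0 = M ∧ b ∈ π.support ∧ (∀ z ∈ π'.support, z ∈ rectangle M N) ∧
      (∀ e ∈ π'.edges, e ∈ ω) ∧ (∀ e ∈ π'.edges, e ∈ π.edges) ∧ (∀ z ∈ π'.support, z ∈ π.support) ∧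
      ∀ z ∈ π'.support, z 0 = M → z = b := by
  classical
  induction π with
  | nil => exact ⟨_, Walk.nil, hc, by simp, hπR, hπω, by simp, by simp, fun z hz _ => by simpa using hz⟩
  | cons h p ih =>
    rename_i u v w
    by_cases hu : u 0 = M
    · exact ⟨u, Walk.nil, hu, by simp, fun z hz => by simp at hz; subst hz; exact hπR _ (by simp), by simp, by simp,
        fun z hz => by simp at hz; subst hz; simp, fun z hz _ => by simpa using hz⟩
    · obtain ⟨b, π', hb, hbmem, hR, hω', hE, hsupp, honly⟩ :=
        ih hc (fun z hz => hπR z (by simp [hz])) (fun e he => hπω e (by simp [he]))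
      refine ⟨b, Walk.cons h π', hb, by simp [hbmem], fun z hz => ?_, fun e he => ?_, fun e he => ?_, fun z hz => ?_,
        fun z hz hz0 => ?_⟩
      · rw [Walk.support_cons, List.mem_cons] at hz
        rcases hz with rfl | hz
        · exact hπR _ (by simp)
        · exact hR z hz
      · rw [Walk.edges_cons, List.mem_cons] at he
        rcases he with rfl | he
        · exact hπω _ (by simp)
        · exact hω' e he
      · rw [Walk.edges_cons, List.mem_cons] at he ⊢
        rcases he with rfl | he
        · exact Or.inl rfl
        · exact Or.inr (hE e he)
      · rw [Walk.support_cons, List.mem_cons] at hz ⊢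
        rcases hz with rfl | hz
        · exact Or.inl rfl
        · exact Or.inr (hsupp z hz)
      · rw [Walk.support_cons, List.mem_cons] at hz
        rcases hz with rfl | hz
        · exact absurd hz0 hu
        · exact honly z hz hz0

end Literature.Probability.Percolation

end
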